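import Summits.BirchSwinnertonDyer.Rank1Residual.X12.O11.RouteUJacobiTwin
import Summits.BirchSwinnertonDyer.Rank1Residual.X12.O11.RouteUPrimeMember
import HarnessLib

/-!
# ROUTE U, the BI-PRIME-MEMBER CLASS THEOREM: BSD₇ for every minimal model of `49a1^{(−q₁q₂)}`,
# `q₁ ≠ q₂` odd primes `≠ 7` with `q₁q₂ ≡ 3 (mod 4)` — from Kriz–Li Thm 1.20 + Rem 3.10, Rubin 1983
# Thm C, Burungale–Flach 2024, Buhler–Gross 1985 (named facts) and TWO Bernoulli-unit certificates

bsd-cm cell (run/shared/lean/pub/bsd-cm/), ROUTE U (Theorem U: BSD(49a1^{(D)}, 7)), seat `bsd-cm-ram`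
(g5). `RouteUPrimeMember.bsdp_seven_of_twist_cm7_prime` is the class theorem for `D = −q` prime; this file
is its verbatim generalisation to `D = −m`, `m = q₁q₂` a product of two distinct odd primes (the six odd
composite members `−15, −39, −51, −55, −87, −95` of the O11 class at `7` with `N < 5·10⁵` are of this shape;
all are unit-case by the cell's census e24954d7e9c5ef63). The character `χ_{−m} = J(· | m)` is the product
`χ_{q₁}↑·χ_{q₂}↑` (`RouteUPrimeTwin.jacobiCharMul_*`: Jacobi values, primitive); the ψ-layer is
`RouteUJacobiPsi` and the descent / twin sides are `RouteUJacobiTwin` (BG85 Ch. II over `M = ℚ(√−m)`,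
Rubin Thm C over `ℚ(√(mr))`, BF24 for the twin's value). Inputs beyond named facts and data: the two
certificates `hcert₁ : ‖B_{1,ω⁴χ_{−m}}‖₇ = 1` (level `7m`) and `hcert₂ : ‖B_{1,ωχ_{−m}χ_{−r}}‖₇ = 1`
(level `7mr`), `r ≡ 3 (mod 4)` an auxiliary prime `∉ {3, 7, q₁, q₂}` with `(−r/7) = (−r/q₁) = (−r/q₂) = 1`
(the Heegner field `K'' = ℚ(√−r)`, in which `7`, `q₁`, `q₂` split). Here: **`bsdp_seven_of_twist_cm7_biprime`**.
No 𝒞₇ / full-BSD corollary is drawn here (for the census members some `qᵢ` is inert in `ℚ(√−7)`, so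
`(W, qᵢ)` is an O10 pair). THEOREMS ONLY; no definitions, no named facts; nothing booked.
References: [KrizLi2019] Thm 1.20, Rem 3.10; [Rubin1983] Thm C; [BurungaleFlach2024] Thm 1.1;
[BuhlerGross1985] Ch. II §§7–9; [Mazur1977] III.5; [Cox2013] Lemma 1.14; [Washington1997] §5.1.
-/

noncomputable section

open scoped Classical
open NumberField WeierstrassCurve DirichletCharacter
open Literature.NumberTheory.EllipticCurves Literature.NumberTheory.EllipticCurves.Rank1Residual
open Literature.NumberTheory.EllipticCurves.KrizLi2019 Literature.NumberTheory.LFunctions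
open Literature.NumberTheory.EllipticCurves.ModularForms
open Literature.NumberTheory.EllipticCurves.Rubin1983 (mulTeichmuller thmC_seven_quadraticField)
open Literature.NumberTheory.QuadraticFields
open Literature.NumberTheory.EllipticCurves.BuhlerGross1985 (firstDescent_seven_oddTwist_of_bernoulli)

namespace Summit.BirchSwinnertonDyer.Rank1Residual.X12.O11.RouteU

/-- **ROUTE U, BI-PRIME-MEMBER CLASS THEOREM.** Let `q₁ ≠ q₂` be primes `≠ 7` with `q₁q₂ ≡ 3 (mod 4)`
(so both odd), and `r ≡ 3 (mod 4)` a prime `∉ {3, 7, q₁, q₂}` with `(−r/7) = (−r/q₁) = (−r/q₂) = 1`.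
Assume the two Bernoulli-unit CERTIFICATES `hcert₁` (`‖B_{1,ω⁴χ_{−q₁q₂}}‖₇ = 1`, for every Teichmüller
`ω` and every character mod `7q₁q₂` with values `J(j|q₁q₂)ω(j)⁴`) and `hcert₂` (`‖B_{1,ωχ_{−q₁q₂}χ_{−r}}‖₇ = 1`,
likewise at level `7q₁q₂r`). Then for every globally minimal `W/ℚ` with `C • W = 49a1^{(−q₁q₂)}`,
`r_an(W) = 1`, every imaginary quadratic `K` with `d_K = −r`, Heegner datum `(D, H, ι, ι₇, P)`,
Mordell–Weil datum `(crd, g)`, `7 ∤ c` (Manin constant of `D`), and the twin's model data: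
**`BSD₇(W)`** — from the named facts Kriz–Li Thm 1.20 / Rem 3.10, Gross–Zagier, Kolyvagin, GZK,
modularity, Rubin 1983 Thm C, Burungale–Flach 2024 and Buhler–Gross 1985 Ch. II, exactly as in the prime
case (`bsdp_seven_of_twist_cm7_prime`), with `χ_{−q₁q₂} = χ_{q₁}↑χ_{q₂}↑` (Jacobi values, primitive).
[cite: KrizLi2019, Thm. 1.20 and Rem. 3.10] [cite: Rubin1983, §0 Thm. C (p. 341)]
[cite: BurungaleFlach2024, Thm 1.1 and Cor. 2] [cite: BuhlerGross1985, Ch. II Prop. (7.2)(2), (8.3)(1), Cor. (9.1) (pp. 16–18)]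
[cite: Mazur1977, Ch. III §5, Step 1 (p. 158)] [cite: Miller2011LMS, Thm. 2.5 and (5.1)] -/
theorem bsdp_seven_of_twist_cm7_biprime {q₁ q₂ r : ℕ} [hq₁ : Fact q₁.Prime] [hq₂ : Fact q₂.Prime]
    [hr : Fact r.Prime]
    (hq12 : q₁ ≠ q₂) (hm4 : (q₁ * q₂) % 4 = 3) (hr4 : r % 4 = 3) (hq₁7 : q₁ ≠ 7) (hq₂7 : q₂ ≠ 7)
    (hr7 : r ≠ 7) (hr3 : r ≠ 3) (hrq₁ : r ≠ q₁) (hrq₂ : r ≠ q₂)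
    (h7split : legendreSym 7 (-(r : ℤ)) = 1) (hsplit₁ : legendreSym q₁ (-(r : ℤ)) = 1)
    (hsplit₂ : legendreSym q₂ (-(r : ℤ)) = 1)
    (hcert₁ : ∀ (ω : DirichletCharacter ℚ_[7] 7), IsTeichmullerCharacter ω →
      ∀ θ : DirichletCharacter ℚ_[7] (7 * (q₁ * q₂)),
        (∀ j : ZMod (7 * (q₁ * q₂)), θ j =
          (jacobiSym (j.val : ℤ) (q₁ * q₂) : ℚ_[7]) * ω (j.val : ZMod 7) ^ 4) →
        ‖generalizedBernoulli 1 θ‖ = 1)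
    (hcert₂ : ∀ (ω : DirichletCharacter ℚ_[7] 7), IsTeichmullerCharacter ω →
      ∀ θ : DirichletCharacter ℚ_[7] (7 * (q₁ * q₂) * r),
        (∀ j : ZMod (7 * (q₁ * q₂) * r), θ j =
          ((jacobiSym (j.val : ℤ) (q₁ * q₂) * jacobiSym (j.val : ℤ) r : ℤ) : ℚ_[7]) *
            ω (j.val : ZMod 7) ^ 1) →
        ‖generalizedBernoulli 1 θ‖ = 1)
    (hKL : KrizLi2019.thm120_padicLogHeegner_unit_of_bernoulli)
    (hRem : KrizLi2019.rem310_padicLogHeegner_integral)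
    (W : WeierstrassCurve ℚ) [W.IsElliptic] [W.IsGloballyMinimal] [NeZero (W.conductorNorm ℤ)]
    (hW : ∃ C : VariableChange ℚ, C • W = cm7.quadraticTwist ((-((q₁ * q₂ : ℕ) : ℤ) : ℤ) : ℚ))
    (K : Type) [Field K] [NumberField K] [NeZero (NumberField.discr K).natAbs]
    (hK : IsImaginaryQuadratic K) (hdK : NumberField.discr K = -(r : ℤ))
    (D : ModularParametrizationData W (W.conductorNorm ℤ))
    (H : HeegnerDatum (W.conductorNorm ℤ) (NumberField.discr K)) (ι : K →+* ℂ) (ιp : K →+* ℚ_[7])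
    (P : (W.baseChange K).toAffine.Point)
    (hGZ : gross_zagier (W.conductorNorm ℤ) W K) (hKo : kolyvagin (W.conductorNorm ℤ) W K)
    (hGZK : rank_eq_analyticRank_of_analyticRank_le_one) (hmod : hasEntireLFunction_rat)
    (hP : WeierstrassCurve.Affine.Point.map ι.toRatAlgHom P = heegnerPointComplex D H)
    (hr1 : W.analyticRank = 1)
    (hLt : (W.quadraticTwist (NumberField.discr K : ℚ)).entireLFunction 1 ≠ 0)
    (Wd : WeierstrassCurve ℚ) [Wd.IsElliptic] [Wd.IsGloballyMinimal] (Cd : VariableChange ℚ)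
    (hWd : Cd • W.quadraticTwist (NumberField.discr K : ℚ) = Wd)
    (hBF : bsdTriple_of_hasCM_of_L_one_ne_zero)
    (hu : padicValRat 7 (Cd.u : ℚ) = 0)
    (hC : Rubin1983.thmC_seven_quadraticField)
    (hBG : BuhlerGross1985.firstDescent_seven_oddTwist_of_bernoulli)
    [Finite (AddCommGroup.torsion (W.baseChange K).toAffine.Point)]
    (crd : (W.baseChange K).toAffine.Point →+ ℤ) (g : (W.baseChange K).toAffine.Point)
    (hg : crd g = 1) (hker : ∀ x, crd x = 0 → IsOfFinAddOrder x)
    (hc7 : ¬ ((7 : ℤ) ∣ D.c)) :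
    BSDp W 7 := by
  -- arithmetic of the parameters
  have hq₁2 : q₁ ≠ 2 := by rintro rfl; omega
  have hq₂2 : q₂ ≠ 2 := by rintro rfl; omega
  have hr2 : r ≠ 2 := by rintro rfl; norm_num at hr4
  have hr7' : r.Coprime 7 := (Nat.coprime_primes hr.out (by norm_num)).mpr hr7
  have hq12' : q₁.Coprime q₂ := (Nat.coprime_primes hq₁.out hq₂.out).mpr hq12
  have hm7 : (q₁ * q₂).Coprime 7 :=
    Nat.Coprime.mul_left ((Nat.coprime_primes hq₁.out (by norm_num)).mpr hq₁7)
      ((Nat.coprime_primes hq₂.out (by norm_num)).mpr hq₂7)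
  have hrm : r.Coprime (q₁ * q₂) :=
    Nat.Coprime.mul_right ((Nat.coprime_primes hr.out hq₁.out).mpr hrq₁)
      ((Nat.coprime_primes hr.out hq₂.out).mpr hrq₂)
  have hsq : Squarefree (q₁ * q₂) := (Nat.squarefree_mul hq12').mpr ⟨hq₁.out.squarefree, hq₂.out.squarefree⟩
  have hm0 : (-((q₁ * q₂ : ℕ) : ℤ)) ≠ 0 := by
    have : 0 < q₁ * q₂ := Nat.pos_of_ne_zero (NeZero.ne _)
    omega
  have hD4 : (-((q₁ * q₂ : ℕ) : ℤ)) % 4 = 1 := by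
    have : (((q₁ * q₂ : ℕ) : ℤ) % 4) = 3 := by exact_mod_cast hm4
    omega
  have h7D : ¬ ((7 : ℤ) ∣ -((q₁ * q₂ : ℕ) : ℤ)) := by
    rw [dvd_neg]
    intro h
    have h' : 7 ∣ q₁ * q₂ := by exact_mod_cast h
    have := Nat.Coprime.eq_one_of_dvd hm7.symm h'
    norm_num at this
  have hnat : (NumberField.discr K).natAbs = r := by rw [hdK]; simp
  haveI : NeZero r := ⟨hr.out.ne_zero⟩
  -- the characters: `ω` Teichmüller mod 7, `χ = χ_{q₁}↑χ_{q₂}↑` mod `q₁q₂`, `ψ = χ·ω²`, `κ' = (·/r)`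
  obtain ⟨ω, hω⟩ := exists_isTeichmullerCharacter (p := 7)
  obtain ⟨χ₁, hχ₁⟩ := exists_legendreCharacter q₁
  obtain ⟨χ₂, hχ₂⟩ := exists_legendreCharacter q₂
  obtain ⟨κ', hκ'⟩ := exists_legendreCharacter r
  set χ : DirichletCharacter ℚ_[7] (q₁ * q₂) :=
    changeLevel (dvd_mul_right q₁ q₂) χ₁ * changeLevel (dvd_mul_left q₂ q₁) χ₂ with hχdef
  have hχ : ∀ a : ℕ, χ (a : ZMod (q₁ * q₂)) = (jacobiSym (a : ℤ) (q₁ * q₂) : ℚ_[7]) :=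
    jacobiCharMul_apply χ₁ χ₂ hχ₁ hχ₂
  have hχp : χ.IsPrimitive := jacobiCharMul_isPrimitive χ₁ χ₂ hq12 hq₁2 hq₂2 hχ₁ hχ₂
  have hκ'J : ∀ a : ℕ, κ' (a : ZMod r) = (jacobiSym (a : ℤ) r : ℚ_[7]) := fun a => by
    rw [hκ', jacobiSym.legendreSym.to_jacobiSym]
  have hκ'p : κ'.IsPrimitive := conductor_eq_of_prime_of_ne_one κ' (legendreChar_ne_one hr2 κ' hκ')
  set ψ : DirichletCharacter ℚ_[7] (7 * (q₁ * q₂)) :=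
    changeLevel (dvd_mul_left (q₁ * q₂) 7) χ * changeLevel (dvd_mul_right 7 (q₁ * q₂)) (ω ^ 2)
    with hψdef
  -- CM data of `W`
  have hCM : W.HasCM := hasCM_of_twist_cm7 W hm0 hW
  have hKj : cmFieldDiscrOfJ W.j = -7 := cmFieldDiscrOfJ_of_twist_cm7 W hm0 hW
  -- the trace hypothesis
  have hss : ∀ ℓ : ℕ, ℓ.Prime → ¬ (ℓ ∣ 7 * W.conductorNorm ℤ) →
      ‖((W.LFunction ℓ : ℤ) : ℚ_[7]) -
        (ψ (ℓ : ZMod (7 * (q₁ * q₂))) + ψ⁻¹ (ℓ : ZMod (7 * (q₁ * q₂))) * ω (ℓ : ZMod 7))‖ < 1 := by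
    have hsq' : Squarefree (-((q₁ * q₂ : ℕ) : ℤ)) := by
      rw [← Int.squarefree_natAbs, Int.natAbs_neg, Int.natAbs_natCast]; exact hsq
    refine hss_twist_cm7 W (D := -((q₁ * q₂ : ℕ) : ℤ)) hD4 hsq' h7D hW ψ ω hω fun ℓ hℓ hℓN => ?_
    haveI := Fact.mk hℓ
    have h7 : ¬ 7 ∣ ℓ := by
      intro h
      have : ℓ = 7 := ((Nat.prime_dvd_prime_iff_eq (by norm_num) hℓ).mp h).symm
      subst this
      exact hℓN (dvd_mul_right 7 _)
    have hnat' : (-((q₁ * q₂ : ℕ) : ℤ)).natAbs = q₁ * q₂ := by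
      rw [Int.natAbs_neg, Int.natAbs_natCast]
    rw [hnat']
    by_cases hc : ℓ.Coprime (q₁ * q₂)
    · rw [hψdef]
      exact psiJ_traceIdentity ω χ hχ ℓ h7 hc
    · have hnu : ¬ IsUnit ((ℓ : ℕ) : ZMod (7 * (q₁ * q₂))) := by
        rw [ZMod.isUnit_iff_coprime, Nat.coprime_mul_iff_right]
        exact fun h => hc h.2
      rw [MulChar.map_nonunit _ hnu, MulChar.map_nonunit _ hnu, zero_mul, add_zero,
        jacobiSym_eq_zero_of_not_coprime hc (NeZero.ne _), Int.cast_zero, zero_mul]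
  -- the Kronecker character of `K = ℚ(√−r)` and the Bernoulli hypothesis
  have hdiv : r ∣ (NumberField.discr K).natAbs := by rw [hnat]
  set εK := changeLevel hdiv κ' with hεKdef
  have hεK : KrizLi2019.IsKroneckerCharacterOf K εK :=
    isKroneckerCharacterOf_changeLevel_jacobi hK.1 (Or.inr ⟨hdK, hr4⟩) κ' hκ'p hκ'J hdiv
  haveI i1 : NeZero (7 * (q₁ * q₂) * (NumberField.discr K).natAbs) := ⟨by rw [hnat]; exact NeZero.ne _⟩
  haveI i2 : NeZero (7 * (q₁ * q₂) * (NumberField.discr K).natAbs * 7) :=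
    ⟨by rw [hnat]; exact NeZero.ne _⟩
  have hB : ¬ (‖bernoulliOnePrim (bernoulliCharOne ψ εK) *
      bernoulliOnePrim (bernoulliCharTwo ψ εK ω)‖ ≤ (7 : ℝ)⁻¹) := by
    have e1 : bernoulliOnePrim (bernoulliCharOne ψ εK) = bernoulliOnePrim (bernoulliCharOne ψ κ') := by
      rw [hεKdef, bernoulliCharOne_changeLevel, bernoulliOnePrim_changeLevel]
    have e2 : bernoulliOnePrim (bernoulliCharTwo ψ εK ω) = bernoulliOnePrim (bernoulliCharTwo ψ κ' ω) := by
      rw [hεKdef, bernoulliCharTwo_changeLevel, bernoulliOnePrim_changeLevel]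
    rw [e1, e2]
    exact bernoulli_hypothesis_of_certs (p := 7) ψ⁻¹ (psiJ_inv_isPrimitive ω χ hm7 hω hχp)
      (dvd_mul_right (7 * (q₁ * q₂)) r)
      (changeLevel ((dvd_mul_left (q₁ * q₂) 7).trans (dvd_mul_right (7 * (q₁ * q₂)) r)) χ *
        changeLevel (dvd_mul_left r (7 * (q₁ * q₂))) κ' *
        changeLevel ((dvd_mul_right 7 (q₁ * q₂)).trans (dvd_mul_right (7 * (q₁ * q₂)) r)) ω)
      (thetaTwoJ_isPrimitive ω χ κ' hm7 hr7' hrm hω hχp hκ'p) (dvd_mul_right (7 * (q₁ * q₂) * r) 7)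
      _ (bernoulliCharOne_psiJ ω χ κ' hm4 hχ) _ (bernoulliCharTwo_psiJ ω χ κ' hm4 hχ)
      (hcert₁ ω hω _ (psiJ_inv_apply ω χ hχ)) (hcert₂ ω hω _ (thetaTwoJ_apply ω χ κ' hχ hκ'J))
  haveI : Fact (Nat.Prime 7) := ⟨by norm_num⟩
  -- the descent inputs: no `7`-torsion over `K` (Mazur at the additive `7`), `Ш(W)[7] = 0` (BG85)
  have hiv : ∀ x : (W.baseChange K).toAffine.Point, 7 • x = 0 → x = 0 :=
    noSevenTorsion_baseChange_of_twist_cm7 W hm0 hW K ιp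
  have hrk : 1 ≤ W.mordellWeilRank := by rw [(hGZK W (by rw [hr1])).1, hr1]
  have hSW : ∀ [Finite W.sha], ¬ 7 ∣ W.shaOrder := fun {_} =>
    not_seven_dvd_shaOrder_of_buhlerGross_J χ hBG hm4 hsq hm7 hχ hχp hcert₁ W hW hrk
  -- splitting of `7`, `q₁`, `q₂` in `K`; the Heegner hypothesis
  have h7K : ((Ideal.span {(7 : ℤ)}).primesOver (𝓞 K)).ncard = 2 := by
    have := ncard_primesOver_eq_two_of_legendreSym hK (ℓ := 7) (by norm_num) (by rw [hdK]; exact h7split)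
    exact_mod_cast this
  have hq₁K : ((Ideal.span {(q₁ : ℤ)}).primesOver (𝓞 K)).ncard = 2 :=
    ncard_primesOver_eq_two_of_legendreSym hK (ℓ := q₁) hq₁2 (by rw [hdK]; exact hsplit₁)
  have hq₂K : ((Ideal.span {(q₂ : ℤ)}).primesOver (𝓞 K)).ncard = 2 :=
    ncard_primesOver_eq_two_of_legendreSym hK (ℓ := q₂) hq₂2 (by rw [hdK]; exact hsplit₂)
  have hbadm : ∀ ℓ : ℕ, (hℓ : ℓ.Prime) → ℓ ≠ 7 →
      ¬ (haveI := Fact.mk hℓ; W.HasGoodReductionAtPrime ℓ) → ℓ = q₁ ∨ ℓ = q₂ := by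
    intro ℓ hℓ hℓ7 hbad
    haveI := Fact.mk hℓ
    have hdvd : (ℓ : ℤ) ∣ -((q₁ * q₂ : ℕ) : ℤ) :=
      dvd_of_not_hasGoodReductionAtPrime_twist_cm7 W hD4 hW ℓ hℓ7 hbad
    rw [dvd_neg] at hdvd
    have hdvd' : ℓ ∣ q₁ * q₂ := by exact_mod_cast hdvd
    rcases (Nat.Prime.dvd_mul hℓ).mp hdvd' with h | h
    · exact Or.inl ((Nat.prime_dvd_prime_iff_eq hℓ hq₁.out).mp h)
    · exact Or.inr ((Nat.prime_dvd_prime_iff_eq hℓ hq₂.out).mp h)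
  have hHN : SatisfiesHeegnerHypothesis (W.conductorNorm ℤ) K := by
    intro p hp hpN
    by_cases hp7 : p = 7
    · subst hp7; exact_mod_cast h7K
    · haveI := Fact.mk hp
      rcases hbadm p hp hp7 (fun hgood => not_dvd_conductorNorm_of_hasGoodReductionAtPrime W hgood hpN)
        with h | h
      · subst h; exact hq₁K
      · subst h; exact hq₂K
  -- the twin side by name, the Tamagawa binders, additivity at `7`
  have hWd' : Cd • W.quadraticTwist ((-(r : ℤ) : ℤ) : ℚ) = Wd := by rw [← hWd, hdK]
  have hSd : ∀ [Finite Wd.sha], ¬ 7 ∣ Wd.shaOrder := fun {_} =>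
    not_seven_dvd_shaOrder_twin_J χ hC hm4 hsq hm7 hr4 hr7 hrm hχ hχp hcert₂ W hW Wd Cd hWd'
  have hmpos : 0 < q₁ * q₂ := Nat.pos_of_ne_zero (NeZero.ne _)
  have htw := twin_value_J hBF hGZK hmod hmpos W hW Wd Cd hWd' (by rw [← hdK]; exact hLt)
  have htamW : ¬ 7 ∣ W.tamagawaProduct :=
    not_dvd_tamagawaProduct_of_hasCM W hCM 7 (by norm_num) (by norm_num)
  have htam : padicValNat 7 Wd.tamagawaProduct = padicValNat 7 W.tamagawaProduct := by
    rw [padicValNat.eq_zero_of_not_dvd htamW, padicValNat.eq_zero_of_not_dvd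
      (not_dvd_tamagawaProduct_of_hasCM Wd (hasCM_twin_prime hmpos hr.out.pos W hW Wd Cd hWd') 7
        (by norm_num) (by norm_num))]
  have hadd : Addv W 7 :=
    X12.addv_of_hasCM_of_cmRamified W 7 hCM (by norm_num) (by rw [CMRamified, hKj]; norm_num)
  have hbad7m : ∀ {ℓ : ℕ}, ℓ.Prime → ℓ ∣ q₁ * q₂ → ¬ ℓ.Coprime (7 * (q₁ * q₂)) := by
    intro ℓ hℓ hdvd hc
    exact hℓ.one_lt.ne' (Nat.Coprime.eq_one_of_dvd (Nat.Coprime.coprime_dvd_right (dvd_mul_left _ 7) hc) hdvd)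
  -- assemble T-U5′
  exact bsdp_of_thm120_of_rem310_of_not_dvd hKL hRem W 7 K D H ι ιp P hGZ hKo hGZK hmod hK hHN hP
    (by norm_num)
    (not_seven_dvd_unitsTorsionOrder hK (by
      rw [hdK]; have := hr.out.five_le_of_ne_two_of_ne_three hr2 hr3; omega))
    hr1 hLt Wd Cd hWd htw htam hu htamW
    hSW hSd
    (7 * (q₁ * q₂)) ψ ω (psiJ_isPrimitive ω χ hm7 hω hχp) hω hss
    (psiJ_apply_natCast_ne_one_of_not_coprime ψ (a := 7) (by
      rw [Nat.coprime_mul_iff_right, not_and_or]; exact Or.inl (by norm_num)))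
    (primVal_invMulOmega_psiJ_ne_one ω χ hm7 hω hχp (a := 7) (by
      rw [Nat.coprime_mul_iff_right, not_and_or]; exact Or.inl (by norm_num)))
    (not_hasSplitMultiplicativeReductionAtPrime_of_hasCM W hCM)
    (fun ℓ hℓ h7ℓ hbad => by
      haveI := Fact.mk hℓ
      have hdvd : ℓ ∣ q₁ * q₂ := by
        rcases hbadm ℓ hℓ h7ℓ hbad.1 with h | h
        · rw [h]; exact dvd_mul_right q₁ q₂
        · rw [h]; exact dvd_mul_left q₂ q₁
      exact ⟨psiJ_apply_natCast_ne_one_of_not_coprime ψ (hbad7m hℓ hdvd),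
        primVal_invMulOmega_psiJ_ne_one ω χ hm7 hω hχp (hbad7m hℓ hdvd)⟩)
    h7K εK hεK hB
    (nsPointCount_seven_of_cmFieldDiscr_eq W hCM hKj)
    crd g hg hker hiv hadd (by norm_num) hc7

end Summit.BirchSwinnertonDyer.Rank1Residual.X12.O11.RouteU

end
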